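import Literature.MathematicalPhysics.QuantumFieldTheory.ConstructiveQFTWave0OddRPProofs
import Literature.MathematicalPhysics.QuantumFieldTheory.LatticeGaugeProofs
import Mathlib.Data.Fintype.Pi
import Mathlib.Data.Fintype.Sigma
import Mathlib.Algebra.BigOperators.Ring.Finset
import Mathlib.Analysis.SpecialFunctions.Exponential
import Mathlib.Analysis.Complex.Exponential
import Mathlib.MeasureTheory.Integral.DominatedConvergence
import HarnessLib

/-!
# Odd-torus reflection positivity with positive-definite EXPONENTIAL weights on the cut plaquettes

Support file (seat ym-infvol-p3, fleet R136 (i); bears on crux `IR` = stmt-QuantumFields-19354 of route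
`BalabanLadder`, line «hamming», clause (ii) `HereditaryRelayRarity` on the ODD tori `(ℤ/(2S+1))⁴` of `GapInUnits`;
count-neutral helper).

On the odd torus `(ℤ/Lℤ)^d`, `L = 2S+1 ≥ 3`, the Osterwalder–Seiler reflection `θ t = 1 - t` fixes the site hyperplane
`t = S+1` AND the hyperplane between the slices `0 | 1`, which CUTS the temporal plaquettes based at `t = 0`
(`WilsonOddRP.IsOCrossPlaq`).  A chessboard estimate for temporal plaquette observables in the time direction therefore
has to carry weights ON the cut plaquettes through the reflection Cauchy–Schwarz step.  Such weights must be
positive-definite class functions of the cut holonomy; this file proves the case needed for exponential (Chebyshev)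
observables:

* `wilsonExpectation_mul_timeReflect_mul_prod_pow_nonneg` — for `β ≥ 0`, `K` real bounded measurable depending on the
  links of the closed positive half `P ∪ M`, a finite set `E` of cut plaquettes and exponents `n`,
  `0 ≤ ⟨K · (K ∘ Θ) · ∏_{q ∈ E} (Re tr ρ U_q)^{n_q}⟩_{Λ,β}` — from the tree's COVARIANT odd reflection positivity
  `wilsonExpectation_nonneg_of_oddCovariant` (the observable has the Gram form `∑_w g_w(z) conj g_w(ΘU)` under the
  Osterwalder–Seiler substitution `U_e ↦ U_e Y_e` on the cut links, the words `w` running over the letters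
  `WilsonOddRP.oCoeff ρ hρ 1 (q, k, l, s)` of the crossing identity `plaqRe_translateLow_of_isOCrossPlaq`);
* `wilsonExpectation_mul_timeReflect_mul_expCut_nonneg` — hence, for `c ≥ 0`,
  `0 ≤ ⟨K · (K ∘ Θ) · exp(c ∑_{q ∈ E} Re tr ρ U_q)⟩_{Λ,β}` (truncated exponential series have non-negative
  coefficients; dominated convergence).

The companion `…OddTorusWeightedRP` turns this, by the coupling shift `β ↦ β - c`, into the reflection Cauchy–Schwarz
inequality with Chebyshev weights `exp(c φ_q)` (`φ_q = N - Re tr ρ U_q`, `0 ≤ c ≤ β`) on an arbitrary set of cut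
plaquettes — the in-plane step of the odd-torus chessboard.

HONEST FRAMING: finite-torus reflection-positivity bookkeeping over tree theorems; nothing here is a statement about the
mass gap or about infinite volume.  References: K. Osterwalder, E. Seiler, Ann. Phys. 110 (1978) 440, §2; E. Seiler,
LNP 159 (1982) Ch. 2; J. Fröhlich, R. Israel, E. H. Lieb, B. Simon, CMP 62 (1978) 1, Thm. 2.1.
-/

noncomputable section

open MeasureTheory Finset Complex Filter Topology
open scoped ComplexOrder ComplexConjugate BigOperators
open Literature.MathematicalPhysics.QuantumFieldTheory
open Literature.MathematicalPhysics.QuantumFieldTheory.WilsonRP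
open Literature.MathematicalPhysics.QuantumFieldTheory.WilsonOddRP

namespace Summit.QuantumFields.YangMills.Theorems.OddTorusChessboard

variable {d L N : ℕ} [NeZero d] [NeZero L] {G : Type*} [Group G] [TopologicalSpace G]
  [IsTopologicalGroup G] [CompactSpace G] [MeasurableSpace G] [BorelSpace G]
  (ρ : G →* Matrix (Fin N) (Fin N) ℂ)

/-! ### §1. The closed positive half `P ∪ M` and the cut links -/

/-- The links of the closed positive half of the odd torus: base time `1 ≤ t ≤ L/2` (`P`) and the spatial links of the
fixed slice `t = L/2 + 1` (`M`). -/
abbrev posHalfEdges : Finset (Edge d L) := oPosEdges ∪ oSharedEdges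

omit [TopologicalSpace G] [IsTopologicalGroup G] [CompactSpace G] [MeasurableSpace G] [BorelSpace G] in
/-- A link of the closed positive half is not a cut link. -/
theorem not_isLowerCross_of_mem_posHalfEdges {e : Edge d L}
    (he : e ∈ ((posHalfEdges : Finset (Edge d L)) : Set (Edge d L))) : ¬ IsLowerCross e := fun hc => by
  rw [Finset.coe_union] at he
  rcases he with he | he
  · exact not_isOPosEdge_of_isLowerCross hc (mem_oPosEdges.1 he)
  · exact not_isOSharedEdge_of_isLowerCross hc (mem_oSharedEdges.1 he)

omit [TopologicalSpace G] [IsTopologicalGroup G] [CompactSpace G] [MeasurableSpace G] [BorelSpace G] in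
/-- The Osterwalder–Seiler substitution on the cut links does not move the links of the closed positive half. -/
theorem translateLow_apply_of_mem_posHalfEdges (Y U : GaugeConfig d L G) {e : Edge d L}
    (he : e ∈ ((posHalfEdges : Finset (Edge d L)) : Set (Edge d L))) : translateLow Y U e = U e :=
  translateLow_apply_of_not_isLowerCross Y U (not_isLowerCross_of_mem_posHalfEdges he)

omit [Group G] [TopologicalSpace G] [IsTopologicalGroup G] [CompactSpace G] [MeasurableSpace G] [BorelSpace G] in
/-- The splice of the cut links does not move the links of the closed positive half. -/
theorem splice_apply_of_mem_posHalfEdges (U Y : GaugeConfig d L G) {e : Edge d L}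
    (he : e ∈ ((posHalfEdges : Finset (Edge d L)) : Set (Edge d L))) :
    LatticeRP.splice lowerEdges (U, Y) e = U e :=
  splice_apply_of_not_isLowerCross U Y (not_isLowerCross_of_mem_posHalfEdges he)

omit [TopologicalSpace G] [IsTopologicalGroup G] [CompactSpace G] [MeasurableSpace G] [BorelSpace G] in
/-- The reflected configuration read on the closed positive half does not see the substitution on the cut links. -/
theorem timeReflect_translateLow_apply_of_mem_posHalfEdges [Fact (1 < L)] (Y U : GaugeConfig d L G) {e : Edge d L}
    (he : e ∈ ((posHalfEdges : Finset (Edge d L)) : Set (Edge d L))) :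
    (translateLow Y U).timeReflect e = U.timeReflect e := by
  have hne : ¬ IsLowerCross (edgeReflect e) := by
    intro hc
    have h := edgeReflect_of_isLowerCross (d := d) (L := L) hc
    rw [edgeReflect_edgeReflect] at h
    rw [h] at he
    exact not_isLowerCross_of_mem_posHalfEdges he hc
  rw [timeReflect_apply, timeReflect_apply, translateLow_apply_of_not_isLowerCross Y U hne]

/-! ### §2. The crossing identity per cut plaquette, with the letters `oCoeff ρ hρ 1` -/

omit [MeasurableSpace G] [BorelSpace G] in
/-- **The Gram form of one cut plaquette.**  For a crossing plaquette `q`,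
`Re tr ρ((translateLow Y U)_q) = ∑_{k,l,s} a_{(q,k,l,s)}(splice(U,Y)) conj a_{(q,k,l,s)}(ΘU)` with the tree's letters
`a = oCoeff ρ hρ 1` (the `β = 1` instance of the crossing Boltzmann letters). -/
theorem sum_oCoeff_one_mul_conj [Fact (1 < L)] (hL : Odd L) (hρ : Continuous ρ) (U Y : GaugeConfig d L G)
    {q : Plaquette d L} (hq : IsOCrossPlaq q) :
    ∑ i : Fin N × Fin N × Bool, oCoeff ρ hρ 1 (q, i) (LatticeRP.splice lowerEdges (U, Y)) *
        conj (oCoeff ρ hρ 1 (q, i) U.timeReflect) =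
      ((plaqRe ρ (translateLow Y U) q : ℝ) : ℂ) := by
  have hs : (Real.sqrt (1 / 2) : ℂ) * (Real.sqrt (1 / 2) : ℂ) = ((1 / 2 : ℝ) : ℂ) := by
    rw [← Complex.ofReal_mul, Real.mul_self_sqrt (by norm_num)]
  rw [plaqRe_translateLow_of_isOCrossPlaq ρ hL hρ U Y hq, Complex.ofReal_sum, Fintype.sum_prod_type]
  refine Finset.sum_congr rfl fun k _ => ?_
  rw [Complex.ofReal_sum, Fintype.sum_prod_type]
  refine Finset.sum_congr rfl fun l _ => ?_
  rw [Fintype.sum_bool]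
  simp only [oCoeff, if_pos hq, ↓reduceIte, Bool.false_eq_true, map_mul, Complex.conj_ofReal,
    Complex.conj_conj]
  set u := Literature.RepresentationTheory.CompactGroups.CompactGroup.unitarize ρ hρ
    (halfPlaq q (LatticeRP.splice lowerEdges (U, Y))) k l
  set v := Literature.RepresentationTheory.CompactGroups.CompactGroup.unitarize ρ hρ
    (halfPlaq q U.timeReflect) k l
  calc (Real.sqrt (1 / 2) : ℂ) * u * ((Real.sqrt (1 / 2) : ℂ) * (starRingEnd ℂ) v) +
        (Real.sqrt (1 / 2) : ℂ) * (starRingEnd ℂ) u * ((Real.sqrt (1 / 2) : ℂ) * v)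
      = ((Real.sqrt (1 / 2) : ℂ) * (Real.sqrt (1 / 2) : ℂ)) *
          (u * (starRingEnd ℂ) v + (starRingEnd ℂ) (u * (starRingEnd ℂ) v)) := by
        simp only [map_mul, Complex.conj_conj]; ring
    _ = (((u * (starRingEnd ℂ) v).re : ℝ) : ℂ) := by
        rw [hs, Complex.add_conj]; push_cast; ring

/-! ### §3. The monomial lemma: products of powers of cut plaquettes against `K · (K ∘ Θ)` -/

section Monomial

variable [Fact (1 < L)]

/-- The Gram words of the monomial `∏_{q ∈ E} (Re tr ρ U_q)^{n_q}` against the observable `K`: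
`g_w(V) = K(V) · ∏_{t} a_{(q_t, w_t)}(V)`, `t` running over the `∑_q n_q` letter positions. -/
def gramWord (hρ : Continuous ρ) (K : GaugeConfig d L G → ℝ) (E : Finset (Plaquette d L)) (n : E → ℕ)
    (w : (Σ q : E, Fin (n q)) → Fin N × Fin N × Bool) (V : GaugeConfig d L G) : ℂ :=
  (K V : ℂ) * ∏ t : (Σ q : E, Fin (n q)), oCoeff ρ hρ 1 ((t.1 : Plaquette d L), w t) V

set_option synthInstance.maxSize 512 in
/-- **Monomial lemma.**  On the odd torus (`L` odd, `L ≥ 3`, `β ≥ 0`, continuous `ρ`): for a real bounded measurable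
`K` depending only on the links of the closed positive half `P ∪ M`, a finite set `E` of CUT plaquettes and exponents
`n`, `0 ≤ ⟨K · (K ∘ Θ) · ∏_{q ∈ E} (Re tr ρ U_q)^{n_q}⟩_{Λ,β}` — the covariant form of Osterwalder–Seiler positivity
(`wilsonExpectation_nonneg_of_oddCovariant`) for the Gram words `gramWord`. -/
theorem wilsonExpectation_mul_timeReflect_mul_prod_pow_nonneg (hL : Odd L) (hL3 : 3 ≤ L) (hρ : Continuous ρ)
    {β : ℝ} (hβ : 0 ≤ β) {K : GaugeConfig d L G → ℝ} (hKm : Measurable K) {K₀ : ℝ} (hKb : ∀ U, |K U| ≤ K₀)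
    (hKdep : DependsOn K ((posHalfEdges : Finset (Edge d L)) : Set (Edge d L)))
    (E : Finset (Plaquette d L)) (hE : ∀ q ∈ E, IsOCrossPlaq q) (n : E → ℕ) :
    0 ≤ wilsonExpectation ρ β fun U : GaugeConfig d L G =>
      K U * K U.timeReflect * ∏ q : E, plaqRe ρ U q ^ n q := by
  classical
  -- the complex observable and its real expectation
  set Φ : GaugeConfig d L G → ℂ := fun U =>
    ((K U * K U.timeReflect * ∏ q : E, plaqRe ρ U q ^ n q : ℝ) : ℂ) with hΦ
  have hreal : wilsonExpectation ρ β Φ =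
      ((wilsonExpectation ρ β fun U : GaugeConfig d L G =>
        K U * K U.timeReflect * ∏ q : E, plaqRe ρ U q ^ n q : ℝ) : ℂ) := by
    unfold wilsonExpectation
    exact integral_ofReal
  suffices h : 0 ≤ wilsonExpectation ρ β Φ by
    rw [hreal] at h
    exact Complex.zero_le_real.1 h
  -- measurability / bounds / dependence of the Gram words
  have hΘm : Measurable (GaugeConfig.timeReflect : GaugeConfig d L G → GaugeConfig d L G) :=
    measurable_timeReflect
  have hΦm : Measurable Φ := by
    refine Complex.measurable_ofReal.comp ?_
    exact (hKm.mul (hKm.comp hΘm)).mul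
      (Finset.measurable_prod _ fun q _ => (measurable_plaqRe ρ hρ _).pow_const _)
  have hgm : ∀ w, Measurable (gramWord ρ hρ K E n w) := fun w =>
    (Complex.measurable_ofReal.comp hKm).mul
      (Finset.measurable_prod _ fun t _ => measurable_oCoeff ρ hρ 1 _)
  have hK0 : 0 ≤ K₀ := (abs_nonneg _).trans (hKb (fun _ => 1))
  have hgb : ∀ w U, ‖gramWord ρ hρ K E n w U‖ ≤ K₀ := by
    intro w U
    rw [gramWord, norm_mul, Complex.norm_real, Real.norm_eq_abs]
    refine (mul_le_mul_of_nonneg_left ?_ (abs_nonneg _)).trans ((mul_one _).le.trans (hKb U))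
    rw [norm_prod]
    refine Finset.prod_le_one (fun _ _ => norm_nonneg _) fun t _ => ?_
    refine (norm_oCoeff_le ρ hρ 1 _ _).trans ?_
    calc Real.sqrt (1 / 2) ≤ Real.sqrt 1 := Real.sqrt_le_sqrt (by norm_num)
      _ = 1 := Real.sqrt_one
  have hsub : ((posHalfEdges : Finset (Edge d L)) : Set (Edge d L)) ⊆
      ((oPosEdges ∪ lowerEdges ∪ oSharedEdges : Finset (Edge d L)) : Set (Edge d L)) := by
    intro e he
    rw [Finset.coe_union] at he
    rcases he with he | he
    · simp [mem_oPosEdges.1 he]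
    · simp [mem_oSharedEdges.1 he]
  have hgdep : ∀ w, DependsOn (gramWord ρ hρ K E n w)
      ((oPosEdges ∪ lowerEdges ∪ oSharedEdges : Finset (Edge d L)) : Set (Edge d L)) := by
    intro w U V hUV
    simp only [gramWord]
    rw [hKdep fun e he => hUV e (hsub he)]
    congr 1
    exact Finset.prod_congr rfl fun t _ => dependsOn_oCoeff ρ hL hρ 1 _ hUV
  refine wilsonExpectation_nonneg_of_oddCovariant ρ hL hL3 hρ hβ hgm hgb hgdep hΦm fun U Y => ?_
  -- the covariance identity `Φ(translateLow Y U) = ∑_w g_w(z) conj g_w(ΘU)`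
  set z := LatticeRP.splice lowerEdges (U, Y) with hz
  have hK1 : K (translateLow Y U) = K z :=
    hKdep fun e he => by rw [translateLow_apply_of_mem_posHalfEdges Y U he, hz, splice_apply_of_mem_posHalfEdges U Y he]
  have hK2 : K (translateLow Y U).timeReflect = K U.timeReflect :=
    hKdep fun e he => timeReflect_translateLow_apply_of_mem_posHalfEdges Y U he
  -- right-hand side: pull out `K z · K(ΘU)` and resum the words
  have hrhs : ∑ w, gramWord ρ hρ K E n w z * conj (gramWord ρ hρ K E n w U.timeReflect) =
      (K z : ℂ) * (K U.timeReflect : ℂ) *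
        ∏ t : (Σ q : E, Fin (n q)), ∑ i : Fin N × Fin N × Bool,
          oCoeff ρ hρ 1 ((t.1 : Plaquette d L), i) z * conj (oCoeff ρ hρ 1 ((t.1 : Plaquette d L), i) U.timeReflect) := by
    rw [Fintype.prod_sum, Finset.mul_sum]
    refine Finset.sum_congr rfl fun w _ => ?_
    simp only [gramWord, map_mul, map_prod, Complex.conj_ofReal]
    rw [Finset.prod_mul_distrib]
    ring
  rw [hrhs]
  -- each letter position carries the crossing identity of its plaquette
  have hlet : ∀ t : (Σ q : E, Fin (n q)),
      ∑ i : Fin N × Fin N × Bool, oCoeff ρ hρ 1 ((t.1 : Plaquette d L), i) z *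
          conj (oCoeff ρ hρ 1 ((t.1 : Plaquette d L), i) U.timeReflect) =
        ((plaqRe ρ (translateLow Y U) t.1 : ℝ) : ℂ) :=
    fun t => sum_oCoeff_one_mul_conj ρ hL hρ U Y (hE _ t.1.2)
  simp_rw [hlet]
  -- regroup the positions `t = (q, m)` into powers
  have hpow : ∏ t : (Σ q : E, Fin (n q)), ((plaqRe ρ (translateLow Y U) t.1 : ℝ) : ℂ) =
      ∏ q : E, ((plaqRe ρ (translateLow Y U) q : ℝ) : ℂ) ^ n q := by
    rw [← Finset.univ_sigma_univ, Finset.prod_sigma]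
    refine Finset.prod_congr rfl fun q _ => ?_
    dsimp only
    rw [Finset.prod_const, Finset.card_univ, Fintype.card_fin]
  rw [hpow, hΦ]
  simp only
  rw [hK1, hK2]
  push_cast
  ring

end Monomial

/-! ### §4. Exponential weights on the cut plaquettes -/

section Exponential

variable [Fact (1 < L)]

/-- The truncated exponential weight `∏_{q ∈ E} ∑_{m < M} (c · Re tr ρ U_q)^m / m!`. -/
def expCutTrunc (c : ℝ) (E : Finset (Plaquette d L)) (M : ℕ) (U : GaugeConfig d L G) : ℝ :=
  ∏ q : E, ∑ m ∈ Finset.range M, (c * plaqRe ρ U q) ^ m / (m.factorial : ℝ)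

omit [NeZero d] [NeZero L] [Fact (1 < L)] [MeasurableSpace G] [BorelSpace G] in
/-- The truncated weight is bounded by `exp(|c| N)^{#E}`. -/
theorem abs_expCutTrunc_le (hρ : Continuous ρ) (c : ℝ) (E : Finset (Plaquette d L)) (M : ℕ)
    (U : GaugeConfig d L G) : |expCutTrunc ρ c E M U| ≤ Real.exp (|c| * N) ^ E.card := by
  unfold expCutTrunc
  rw [Finset.abs_prod]
  calc ∏ q : E, |∑ m ∈ Finset.range M, (c * plaqRe ρ U q) ^ m / (m.factorial : ℝ)|
      ≤ ∏ _q : E, Real.exp (|c| * N) := by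
        refine Finset.prod_le_prod (fun _ _ => abs_nonneg _) fun q _ => ?_
        calc |∑ m ∈ Finset.range M, (c * plaqRe ρ U q) ^ m / (m.factorial : ℝ)|
            ≤ ∑ m ∈ Finset.range M, |(c * plaqRe ρ U q) ^ m / (m.factorial : ℝ)| := Finset.abs_sum_le_sum_abs _ _
          _ = ∑ m ∈ Finset.range M, |c * plaqRe ρ U q| ^ m / (m.factorial : ℝ) := by
              refine Finset.sum_congr rfl fun m _ => ?_
              rw [abs_div, abs_pow, Nat.abs_cast]
          _ ≤ Real.exp |c * plaqRe ρ U q| := Real.sum_le_exp_of_nonneg (abs_nonneg _) _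
          _ ≤ Real.exp (|c| * N) := by
              refine Real.exp_le_exp.2 ?_
              rw [abs_mul]
              exact mul_le_mul_of_nonneg_left (abs_plaqRe_le ρ hρ U q) (abs_nonneg _)
    _ = Real.exp (|c| * N) ^ E.card := by
        rw [Finset.prod_const, Finset.card_univ, Fintype.card_coe]

omit [NeZero d] [NeZero L] [Fact (1 < L)] [CompactSpace G] in
/-- The truncated weight is measurable. -/
theorem measurable_expCutTrunc (hρ : Continuous ρ) (c : ℝ) (E : Finset (Plaquette d L)) (M : ℕ) :
    Measurable (expCutTrunc (G := G) ρ c E M) := by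
  unfold expCutTrunc
  refine Finset.measurable_prod _ fun q _ => Finset.measurable_sum _ fun m _ => ?_
  exact (((measurable_plaqRe ρ hρ _).const_mul c).pow_const m).div_const _

omit [NeZero d] [NeZero L] [Fact (1 < L)] [TopologicalSpace G] [IsTopologicalGroup G] [CompactSpace G] [MeasurableSpace G]
  [BorelSpace G] in
/-- The truncated weights converge to the exponential weight. -/
theorem tendsto_expCutTrunc (c : ℝ) (E : Finset (Plaquette d L)) (U : GaugeConfig d L G) :
    Tendsto (fun M => expCutTrunc ρ c E M U) atTop
      (𝓝 (Real.exp (c * ∑ q ∈ E, plaqRe ρ U q))) := by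
  have hlim : Real.exp (c * ∑ q ∈ E, plaqRe ρ U q) = ∏ q : E, Real.exp (c * plaqRe ρ U q) := by
    rw [Finset.mul_sum, Real.exp_sum, ← Finset.prod_coe_sort]
  rw [hlim]
  unfold expCutTrunc
  refine tendsto_finsetProd _ fun q _ => ?_
  have h := NormedSpace.expSeries_div_hasSum_exp (c * plaqRe ρ U q)
  rw [← congr_fun Real.exp_eq_exp_ℝ (c * plaqRe ρ U q)] at h
  exact h.tendsto_sum_nat

/-- **Exponential cut weights are reflection positive.**  On the odd torus (`L` odd, `L ≥ 3`, `β ≥ 0`, continuous `ρ`):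
for `c ≥ 0`, a real bounded measurable `K` depending only on the links of the closed positive half `P ∪ M`, and a
finite set `E` of CUT plaquettes, `0 ≤ ⟨K · (K ∘ Θ) · exp(c ∑_{q ∈ E} Re tr ρ U_q)⟩_{Λ,β}` (the truncated exponentials
are non-negative combinations of the monomials of `wilsonExpectation_mul_timeReflect_mul_prod_pow_nonneg`; dominated
convergence). -/
theorem wilsonExpectation_mul_timeReflect_mul_expCut_nonneg (hL : Odd L) (hL3 : 3 ≤ L) (hρ : Continuous ρ)
    {β : ℝ} (hβ : 0 ≤ β) {c : ℝ} (hc : 0 ≤ c) {K : GaugeConfig d L G → ℝ} (hKm : Measurable K) {K₀ : ℝ}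
    (hKb : ∀ U, |K U| ≤ K₀) (hKdep : DependsOn K ((posHalfEdges : Finset (Edge d L)) : Set (Edge d L)))
    (E : Finset (Plaquette d L)) (hE : ∀ q ∈ E, IsOCrossPlaq q) :
    0 ≤ wilsonExpectation ρ β fun U : GaugeConfig d L G =>
      K U * K U.timeReflect * Real.exp (c * ∑ q ∈ E, plaqRe ρ U q) := by
  classical
  haveI := isProbabilityMeasure_wilsonMeasure (d := d) (L := L) (G := G) ρ hρ β
  have hΘm : Measurable (GaugeConfig.timeReflect : GaugeConfig d L G → GaugeConfig d L G) :=
    measurable_timeReflect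
  have hK0 : 0 ≤ K₀ := (abs_nonneg _).trans (hKb (fun _ => 1))
  have hKK : ∀ U : GaugeConfig d L G, |K U * K U.timeReflect| ≤ K₀ * K₀ := fun U => by
    rw [abs_mul]; exact mul_le_mul (hKb _) (hKb _) (abs_nonneg _) hK0
  -- the truncated observables and their non-negative expectations
  set F : ℕ → GaugeConfig d L G → ℝ := fun M U => K U * K U.timeReflect * expCutTrunc ρ c E M U with hF
  have hFnonneg : ∀ M, 0 ≤ ∫ U, F M U ∂(wilsonMeasure ρ β) := by
    intro M
    -- expand the product of truncated series into monomials
    have hexp : ∀ U : GaugeConfig d L G, F M U =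
        ∑ n ∈ Fintype.piFinset (fun _ : E => Finset.range M),
          (∏ q : E, c ^ n q / ((n q).factorial : ℝ)) * (K U * K U.timeReflect * ∏ q : E, plaqRe ρ U q ^ n q) := by
      intro U
      simp only [hF, expCutTrunc]
      rw [Finset.prod_univ_sum, Finset.mul_sum]
      refine Finset.sum_congr rfl fun n _ => ?_
      rw [show (∏ q : E, (c * plaqRe ρ U q) ^ n q / ((n q).factorial : ℝ)) =
          (∏ q : E, c ^ n q / ((n q).factorial : ℝ)) * ∏ q : E, plaqRe ρ U q ^ n q by
        rw [← Finset.prod_mul_distrib]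
        refine Finset.prod_congr rfl fun q _ => ?_
        rw [mul_pow]; ring]
      ring
    have hint : ∀ n : E → ℕ, Integrable (fun U : GaugeConfig d L G =>
        (∏ q : E, c ^ n q / ((n q).factorial : ℝ)) * (K U * K U.timeReflect * ∏ q : E, plaqRe ρ U q ^ n q))
        (wilsonMeasure ρ β) := by
      intro n
      refine Integrable.const_mul ?_ _
      refine Integrable.of_bound (((hKm.mul (hKm.comp hΘm)).mul
        (Finset.measurable_prod _ fun q _ => (measurable_plaqRe ρ hρ _).pow_const _)).aestronglyMeasurable)
        (K₀ * K₀ * ∏ q : E, (N : ℝ) ^ n q) (ae_of_all _ fun U => ?_)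
      rw [Real.norm_eq_abs, abs_mul, Finset.abs_prod]
      refine mul_le_mul (hKK U) (Finset.prod_le_prod (fun _ _ => abs_nonneg _) fun q _ => ?_)
        (Finset.prod_nonneg fun _ _ => abs_nonneg _) (mul_nonneg hK0 hK0)
      rw [abs_pow]
      exact pow_le_pow_left₀ (abs_nonneg _) (abs_plaqRe_le ρ hρ U q) _
    rw [integral_congr_ae (ae_of_all _ hexp), integral_finsetSum _ fun n _ => hint n]
    refine Finset.sum_nonneg fun n _ => ?_
    rw [integral_const_mul]
    refine mul_nonneg (Finset.prod_nonneg fun q _ => div_nonneg (pow_nonneg hc _) (Nat.cast_nonneg _)) ?_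
    exact wilsonExpectation_mul_timeReflect_mul_prod_pow_nonneg ρ hL hL3 hρ hβ hKm hKb hKdep E hE n
  -- dominated convergence
  have hlim : Tendsto (fun M => ∫ U, F M U ∂(wilsonMeasure ρ β)) atTop
      (𝓝 (∫ U, K U * K U.timeReflect * Real.exp (c * ∑ q ∈ E, plaqRe ρ U q) ∂(wilsonMeasure ρ β))) := by
    refine tendsto_integral_of_dominated_convergence (fun _ => K₀ * K₀ * Real.exp (|c| * N) ^ E.card)
      (fun M => ((hKm.mul (hKm.comp hΘm)).mul (measurable_expCutTrunc ρ hρ c E M)).aestronglyMeasurable)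
      (integrable_const _) (fun M => ae_of_all _ fun U => ?_) (ae_of_all _ fun U => ?_)
    · rw [hF, Real.norm_eq_abs, abs_mul]
      exact mul_le_mul (hKK U) (abs_expCutTrunc_le ρ hρ c E M U) (abs_nonneg _) (mul_nonneg hK0 hK0)
    · exact (tendsto_expCutTrunc ρ c E U).const_mul _
  exact ge_of_tendsto' hlim hFnonneg

end Exponential

end Summit.QuantumFields.YangMills.Theorems.OddTorusChessboard

end
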